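import Mathlib
import HarnessLib
import Literature.AlgebraicGeometry.Ramification.InertiaNormalSylow
import Summits.ResolutionOfSingularities.ResolutionOfSingularities.Theorems.WildQuotientsWildQuotientResolutionPointBlowupResidue

/-!
# Residue fields of chart localizations are generated by the chart coordinates; point blow-up step, chart form (crux `WildQuotients.WildQuotientResolution`)

Crux stmt-ResolutionOfSingularities-15640 (`WildQuotientResolution`), registered stub
`stub_phaseZeroHighDim`, move-game track; third storey of memo `PHASE0-DIM3-TERMINATION.md` §1
(«on a threefold, point moves create no NPC curves; NPC points over `z` are `κ(z)`-rational»).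
✓`PointBlowupResidue.hasNormalSylow_of_pointBlowupStep_of_residue` reduced p-closedness of the
inertia at `x` over the blown-up closed point `z` to the existence of ONE blow-up coordinate with
residue outside `κ(z)`. Here that existence is derived from `κ(x) ≠ κ(z)` in the shape delivered
by the tree's chart theorem `Literature.….IsBlowup.exists_reesChart_stalk` (`S = 𝒪_{X♯,x}` is the
localization at a prime `𝔴` of a chart ring `B` over `R = 𝒪_{X′,z}`, through `χ : B → S` with
`χ ∘ ψ = ι`): if `B` is generated modulo `𝔴` by elements `g_j` (for the Rees chart: the
`(c_j t)/(c_i t)`, which generate `B/(c_i) ≅ κ[T_j]` — `chartQuotMap_bijective`), then the residue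
field `κ(S)` is the field of fractions of the `κ(R)`-algebra generated by the residues of the
`χ(g_j)`; so if all of these lie in `κ(R)`, the residue map `κ(R) → κ(S)` is ONTO. Contrapositive +
the previous storey: a non-surjective residue field extension at `x` (every non-closed point of
the exceptional divisor, every closed point with `κ(x) ≠ κ(z)`) forces `I_x` p-closed, on a
threefold. What is still left to a hand with the chart files: instantiate `B, ψ, χ, 𝔴, g` with
`exists_reesChart_stalk` + `chartQuotMap_bijective` inside `PointBlowupStalkData` (size S–M).

* `residue_eval₂_mem_fieldRange` — bookkeeping: residues of polynomial expressions in the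
  generators lie in the subfield generated when the generators' residues do.
* `surjective_residueFieldMap_of_generators` — the residue field criterion.
* `hasNormalSylow_of_pointBlowupStep_of_chart` — the point blow-up step in chart form: embedding
  dimension `3`, `κ(R) → κ(S)` not surjective ⇒ `I` p-closed.

[OURS · crux stmt-ResolutionOfSingularities-15640 · helper toward `stub_phaseZeroHighDim`
(threefold Phase 0); folklore commutative algebra, counted 0; AI-level work, weaker than expert
review.]
-/

-- single-problem summit: the doubled namespace component `ResolutionOfSingularities` is forced
set_option linter.dupNamespace false

open IsLocalRing Literature.AlgebraicGeometry.Ramification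
open Summit.ResolutionOfSingularities.ResolutionOfSingularities.Theorems.WildQuotientResolution.PointBlowupResidue

namespace Summit.ResolutionOfSingularities.ResolutionOfSingularities.Theorems.WildQuotientResolution.ChartResidueField

/-- Bookkeeping: if `f : R → F` takes values in a subfield `E` on constants and the values `v j`
lie in `E`, then every `MvPolynomial.eval₂ f v P` lies in `E`. [folklore] -/
theorem eval₂_mem_subfield {R F : Type*} [CommRing R] [Field F] {σ : Type*}
    (E : Subfield F) (f : R →+* F) (hf : ∀ a, f a ∈ E) (v : σ → F) (hv : ∀ j, v j ∈ E)
    (P : MvPolynomial σ R) : MvPolynomial.eval₂ f v P ∈ E := by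
  induction P using MvPolynomial.induction_on with
  | C a => rw [MvPolynomial.eval₂_C]; exact hf a
  | add p q hp hq => rw [MvPolynomial.eval₂_add]; exact add_mem hp hq
  | mul_X p j hp => rw [MvPolynomial.eval₂_mul, MvPolynomial.eval₂_X]; exact mul_mem hp (hv j)

/-- **Residue fields of localized charts.** Let `ι : R → S` be a local homomorphism of local rings
factoring as `R —ψ→ B —χ→ S`, where `S` is the localization of `B` at a prime `𝔴` (through `χ`)
and `B` is generated modulo `𝔴` by elements `g_j` (`∀ b, ∃ P, eval₂ ψ g P − b ∈ 𝔴`). If the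
residue class of every `χ(g_j)` lies in the image of `κ(R) → κ(S)`, then `κ(R) → κ(S)` is
surjective: every element of `S` is `χ(b)/χ(b′)` with `b′ ∉ 𝔴`, and the residues of `χ(b)`,
`χ(b′)` are polynomial in those of the `χ(g_j)` with coefficients from `κ(R)`. [folklore] -/
theorem surjective_residueFieldMap_of_generators
    {R B S : Type*} [CommRing R] [IsLocalRing R] [CommRing B] [CommRing S] [IsLocalRing S]
    (ι : R →+* S) [IsLocalHom ι] (ψ : R →+* B) (χ : B →+* S) (hχψ : ∀ a, χ (ψ a) = ι a)
    (𝔴 : Ideal B) [𝔴.IsPrime] [Algebra B S] (halg : ∀ b, algebraMap B S b = χ b)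
    [IsLocalization.AtPrime S 𝔴]
    {σ : Type*} (g : σ → B)
    (hgenB : ∀ b : B, ∃ P : MvPolynomial σ R, MvPolynomial.eval₂ ψ g P - b ∈ 𝔴)
    (hg : ∀ j, residue S (χ (g j)) ∈ Set.range (ResidueField.map ι)) :
    Function.Surjective (ResidueField.map ι) := by
  classical
  set E : Subfield (ResidueField S) := (ResidueField.map ι).fieldRange with hE
  have hmemE : ∀ y, y ∈ E ↔ y ∈ Set.range (ResidueField.map ι) := fun y => by
    rw [hE, RingHom.mem_fieldRange]; rfl
  -- `χ(𝔴) ⊆ 𝔫_S` and `χ(B ∖ 𝔴) ⊆ Sˣ`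
  have hwmax : ∀ b ∈ 𝔴, χ b ∈ maximalIdeal S := fun b hb => by
    rw [← halg]; exact (IsLocalization.AtPrime.to_map_mem_maximal_iff S 𝔴 b).mpr hb
  -- residues of `χ b` lie in `E`
  have hres : ∀ b : B, residue S (χ b) ∈ E := by
    intro b
    obtain ⟨P, hP⟩ := hgenB b
    have heq : residue S (χ b) = residue S (χ (MvPolynomial.eval₂ ψ g P)) := by
      rw [eq_comm, ← sub_eq_zero, ← map_sub, ← map_sub, residue_eq_zero_iff]
      exact hwmax _ hP
    rw [heq, ← MvPolynomial.coe_eval₂Hom, ← RingHom.comp_apply, ← RingHom.comp_apply,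
      MvPolynomial.comp_eval₂Hom, MvPolynomial.coe_eval₂Hom]
    refine eval₂_mem_subfield E _ (fun a => ?_) _ (fun j => (hmemE _).mpr (hg j)) P
    rw [RingHom.comp_apply, RingHom.comp_apply, hχψ, ← ResidueField.map_residue]
    exact (hmemE _).mpr ⟨_, rfl⟩
  -- every residue class of `S` is a quotient of two such
  intro y
  obtain ⟨s, rfl⟩ := residue_surjective y
  obtain ⟨⟨b, b'⟩, hbb'⟩ := IsLocalization.mk'_surjective 𝔴.primeCompl s
  simp only at hbb'
  have hspec := IsLocalization.mk'_spec S b b'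
  rw [hbb', halg, halg] at hspec
  -- `residue s * residue (χ b') = residue (χ b)`, `residue (χ b') ≠ 0`
  have hunit : IsUnit (χ (b' : B)) := by
    rw [← halg]; exact IsLocalization.map_units S b'
  have hb'0 : residue S (χ (b' : B)) ≠ 0 := by
    rw [Ne, residue_eq_zero_iff, mem_maximalIdeal, mem_nonunits_iff, not_not]
    exact hunit
  have hy : residue S s = residue S (χ b) * (residue S (χ (b' : B)))⁻¹ := by
    rw [eq_mul_inv_iff_mul_eq₀ hb'0, ← map_mul, hspec]
  have hyE : residue S s ∈ E := by
    rw [hy]; exact mul_mem (hres b) (inv_mem (hres _))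
  exact (hmemE _).mp hyE

set_option maxHeartbeats 400000 in
/-- **Point blow-up step on a threefold, chart form.** In the setting of
✓`hasNormalSylow_of_pointBlowupStep_of_residue` (`ι : R → S` injective local, `𝔪_R S = (ι t)`,
`𝔪_R` generated by three elements, `I` finite acting on `R` faithfully and on `S` compatibly and
residue-trivially, residue characteristics `p`), suppose moreover that `S` is the localization at
a prime `𝔴` of an `R`-algebra `B` (`R —ψ→ B —χ→ S`, `χ ∘ ψ = ι`) generated modulo `𝔴` by elements
`g_j` each of which is a BLOW-UP COORDINATE (`χ(g_j) · ι t = ι(r_j)` with `r_j ∈ 𝔪_R`) — the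
shape delivered by `IsBlowup.exists_reesChart_stalk`, `g_j = (c_j t)/(c_i t)`, `r_j = c_j`,
`t = c_i`. If the residue field extension `κ(R) → κ(S)` is NOT surjective, then `I` has a normal
Sylow `p`-subgroup. (On a threefold: every non-`κ(z)`-rational point over a blown-up closed point —
in particular every non-closed point of the exceptional divisor — has p-closed inertia: point
moves create no NPC curves.) [folklore] -/
theorem hasNormalSylow_of_pointBlowupStep_of_chart (p : ℕ) [Fact p.Prime]
    {R S : Type*} [CommRing R] [IsLocalRing R] [IsNoetherianRing R]
    [CommRing S] [IsLocalRing S] [IsDomain S]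
    [CharP (ResidueField R) p] [CharP (ResidueField S) p]
    (ι : R →+* S) [IsLocalHom ι] (hι : Function.Injective ι)
    (t : R) (ht : t ∈ maximalIdeal R)
    (hgen : Ideal.map ι (maximalIdeal R) = Ideal.span {ι t})
    {I : Type*} [Group I] [Finite I] (τ : I →* (R ≃+* R)) (τ₁ : I →* (S ≃+* S))
    (hτ : Function.Injective τ) (hcomp : ∀ (g : I) (r : R), ι (τ g r) = τ₁ g (ι r))
    (hres : ∀ (g : I) (s : S), τ₁ g s - s ∈ maximalIdeal S)
    (x : Fin 3 → R) (hx : Ideal.span (Set.range x) = maximalIdeal R)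
    {B : Type*} [CommRing B] (ψ : R →+* B) (χ : B →+* S) (hχψ : ∀ a, χ (ψ a) = ι a)
    (𝔴 : Ideal B) [𝔴.IsPrime] [Algebra B S] (halg : ∀ b, algebraMap B S b = χ b)
    [IsLocalization.AtPrime S 𝔴]
    {σ : Type*} (g : σ → B)
    (hgenB : ∀ b : B, ∃ P : MvPolynomial σ R, MvPolynomial.eval₂ ψ g P - b ∈ 𝔴)
    (hcoord : ∀ j, ∃ r ∈ maximalIdeal R, χ (g j) * ι t = ι r)
    (hnsurj : ¬ Function.Surjective (ResidueField.map ι)) :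
    HasNormalSylow p I := by
  classical
  -- some generator has residue outside `κ(R)`
  have hex : ∃ j, residue S (χ (g j)) ∉ Set.range (ResidueField.map ι) := by
    by_contra h
    exact hnsurj (surjective_residueFieldMap_of_generators ι ψ χ hχψ 𝔴 halg g hgenB
      fun j => not_not.mp (not_exists.mp h j))
  obtain ⟨j, hj⟩ := hex
  obtain ⟨r₁, hr₁, hr₁t⟩ := hcoord j
  -- degenerate case `t = 0`: then `𝔪_R = 0`, the residue-trivial faithful action is trivial
  by_cases ht0 : t = 0
  · have hm0 : ∀ r ∈ maximalIdeal R, r = 0 := fun r hr => by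
      have h1 : ι r ∈ Ideal.span {ι t} := hgen ▸ Ideal.mem_map_of_mem ι hr
      rw [ht0, map_zero, Ideal.span_singleton_zero, Ideal.mem_bot] at h1
      exact hι (by rw [map_zero]; exact h1)
    have hresR : ∀ (g : I) (r : R), τ g r - r ∈ maximalIdeal R := fun g r => by
      have h : ι (τ g r - r) ∈ maximalIdeal S := by rw [map_sub, hcomp]; exact hres g (ι r)
      rw [mem_maximalIdeal, mem_nonunits_iff] at h ⊢
      exact fun hu => h (hu.map ι)
    have htriv : ∀ g : I, g = 1 := fun g => hτ (by
      rw [map_one]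
      ext r
      have := hm0 _ (hresR g r)
      rw [sub_eq_zero] at this
      rw [this, RingAut.one_apply])
    haveI : Subsingleton I := ⟨fun a b => by rw [htriv a, htriv b]⟩
    exact HasNormalSylow.of_isPGroup (IsPGroup.of_card (n := 0) (by
      rw [pow_zero]; exact Nat.card_of_subsingleton (1 : I)))
  -- `ι t ≠ 0`: the blow-up coordinate of `r₁` is unique, `= χ (g j)`
  have hu0 : ι t ≠ 0 := fun h => ht0 (hι (by rw [map_zero]; exact h))
  refine hasNormalSylow_of_pointBlowupStep_of_residue p ι hι t ht hgen τ τ₁ hτ hcomp hres x hx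
    r₁ hr₁ fun s hs => ?_
  have hs' : s = χ (g j) := mul_right_cancel₀ hu0 (hs.trans hr₁t.symm)
  rw [hs']
  exact hj

end Summit.ResolutionOfSingularities.ResolutionOfSingularities.Theorems.WildQuotientResolution.ChartResidueField
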